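import Summits.AtomisticToContinuum.HydrodynamicLimit.Theorems.InformationPercolationEnginePercolationClosesChaosDockingOwners
import Literature.MathematicalPhysics.KineticTheory.HardSphereCrossSection
import HarnessLib

/-!
# Flux-average stability under bin-scale velocity perturbations — analytic atoms of the oscillation lemma of stub S8
(line `equilibrium-forecast-chain-rule`, crux `InformationPercolationEngine.PercolationClosesChaos`, stmt-AtomisticToContinuum-15178)

Support file (`--supports stmt-AtomisticToContinuum-15178`) of the registered stub `stub_revealedDefectStability` (worker W6 of
lead c3). The deterministic oscillation lemma `DefectOscDomination` of the S8 audit (`…RevealedDefectReduction.lean`) bounds the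
oscillation of `unitDefect Ψ` over a revealed atom by the rough-collision share plus terms vanishing with the bin width; its
P-TERM is the stability of the flux-weighted pair average `pairPair Ψ / pairPair 1 = Σ fluxAvg Ψ(v_i, v_j) / Σ π‖v_i − v_j‖`
of two TAME step-start populations when every velocity moves by at most `β = √3 b` inside its bin. This file proves that step
in abstract finite-family form, `abs_fluxRatio_sub_le`:
`|Σ_S fluxAvg Ψ(u)/Σ_S fluxAvg 1(u) − (same at u')| ≤ m + 4C(E₀/V + E₀√E₀/V²)/s₀ + 10 C β/s₀`
for `S ⊆ P × Q` carrying relative speed `≥ s₀ #P #Q` (not cold), energy caps `Σ‖u‖² ≤ E₀ #·` on `P, Q` (not hot),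
`|Ψ| ≤ C`, and a modulus `m` of `Ψ` at scale `β` on speeds `≤ V`, together with its atoms: `fluxAvg_one_eq` (`∫(u·ω)₊ = π|u|`),
`abs_hardSphereKernel_sub_le`, `sphereMeasure_real_univ_V3` (`|S²| = 4π`), the registered headline `abs_fluxAvg_sub_fluxAvg_le`
(`|fluxAvg Ψ v w − fluxAvg Ψ v' w'| ≤ m π‖w − v‖ + 4πC‖Δ(w − v)‖`), the ratio lemma `abs_div_sub_div_le_of_le_mul`, and the
energy-cap bookkeeping `card_fast_le`, `sum_fast_norm_le`, `sum_norm_le_card_mul_sqrt`, `sum_fast_pairs_le` (fast pairs carry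
flux `≤ 2 #P #Q (E₀/V + E₀√E₀/V²)`). Elementary real analysis on the sphere (`integral_hardSphereKernel_eq_pi_mul_norm`,
Cercignani–Illner–Pulvirenti 1994 §3.1).
-/

noncomputable section

open MeasureTheory Set Filter Topology
open scoped ENNReal BigOperators Classical
open Literature.Analysis.FluidPDE Literature.MathematicalPhysics.KineticTheory
open Literature.MathematicalPhysics.KineticTheory.VelocityBlindPlacement

namespace Summit.AtomisticToContinuum.HydrodynamicLimit.Theorems.EquilibriumForecastLine

/-- `fluxAvg 1 v w = π ‖w − v‖` (`integral_hardSphereKernel_eq_pi_mul_norm`). [folklore] -/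
theorem fluxAvg_one_eq (v w : V3) : fluxAvg (fun _ => 1) v w = Real.pi * ‖w - v‖ := by
  unfold fluxAvg
  simp only [one_mul]
  exact integral_hardSphereKernel_eq_pi_mul_norm w v

/-- The hard-sphere kernel is `1`-Lipschitz in the relative velocity on the unit sphere:
`|((w−v)·ω)₊ − ((w'−v')·ω)₊| ≤ ‖(w − v) − (w' − v')‖`. [folklore] -/
theorem abs_hardSphereKernel_sub_le (v w v' w' : V3) (ω : Metric.sphere (0 : V3) 1) :
    |hardSphereKernel (w, v) ω - hardSphereKernel (w', v') ω| ≤ ‖(w - v) - (w' - v')‖ := by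
  unfold hardSphereKernel
  calc |max (inner ℝ (w - v) (ω : V3)) 0 - max (inner ℝ (w' - v') (ω : V3)) 0|
      ≤ |inner ℝ (w - v) (ω : V3) - inner ℝ (w' - v') (ω : V3)| := abs_max_sub_max_le_abs _ _ _
    _ = |inner ℝ ((w - v) - (w' - v')) (ω : V3)| := by rw [← inner_sub_left]
    _ ≤ ‖(w - v) - (w' - v')‖ * ‖(ω : V3)‖ := abs_real_inner_le_norm _ _
    _ = ‖(w - v) - (w' - v')‖ := by rw [norm_coe_unitSphere, mul_one]

/-- `|S²| = 4π` for the sphere measure on the unit sphere of `ℝ³` (`toSphere_apply_univ`, `volume_ball_fin_three`). [folklore] -/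
theorem sphereMeasure_real_univ_V3 : (sphereMeasure : Measure (Metric.sphere (0 : V3) 1)).real univ = 4 * Real.pi := by
  rw [measureReal_def, sphereMeasure, Measure.toSphere_apply_univ, finrank_euclideanSpace_fin,
    EuclideanSpace.volume_ball_fin_three, ENNReal.ofReal_one, one_pow, one_mul, Nat.cast_ofNat,
    ENNReal.toReal_mul, ENNReal.toReal_ofReal (by positivity)]
  norm_num
  ring

/-- **Registered headline `abs_fluxAvg_sub_fluxAvg_le`: perturbation of a flux average.** If `|Ψ| ≤ C` and
`|Ψ(ω, v, w) − Ψ(ω, v', w')| ≤ m` for all impact directions `ω`, then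
`|fluxAvg Ψ v w − fluxAvg Ψ v' w'| ≤ m · π ‖w − v‖ + 4π C ‖(w − v) − (w' − v')‖` (split
`Ψk − Ψ'k' = (Ψ − Ψ')k + Ψ'(k − k')`, `∫ k = π‖w − v‖`, `|k − k'| ≤ ‖Δ(w − v)‖`, `|S²| = 4π`). [folklore] -/
theorem abs_fluxAvg_sub_fluxAvg_le : ∀ {Ψ : V3 × V3 × V3 → ℝ}, Continuous Ψ → ∀ {C : ℝ}, (∀ p, |Ψ p| ≤ C) → ∀ (v w v' w' : V3) {m : ℝ}, (∀ ω : Metric.sphere (0 : V3) 1, |Ψ ((ω : V3), v, w) - Ψ ((ω : V3), v', w')| ≤ m) → |fluxAvg Ψ v w - fluxAvg Ψ v' w'| ≤ m * (Real.pi * ‖w - v‖) + 4 * Real.pi * C * ‖(w - v) - (w' - v')‖ := by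
  intro Ψ hΨc C hΨ v w v' w' m hm
  haveI := isFiniteMeasure_sphereMeasure_V3
  have hC : 0 ≤ C := (abs_nonneg _).trans (hΨ 0)
  have hk : ∀ a b : V3, Continuous fun ω : Metric.sphere (0 : V3) 1 => hardSphereKernel (a, b) ω := by
    intro a b; unfold hardSphereKernel; fun_prop
  have hf : ∀ a b : V3, Continuous fun ω : Metric.sphere (0 : V3) 1 => Ψ ((ω : V3), a, b) := fun a b =>
    hΨc.comp (by fun_prop)
  set f₁ : Metric.sphere (0 : V3) 1 → ℝ := fun ω => Ψ ((ω : V3), v, w) * hardSphereKernel (w, v) ω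
  set f₂ : Metric.sphere (0 : V3) 1 → ℝ := fun ω => Ψ ((ω : V3), v', w') * hardSphereKernel (w', v') ω
  set g₁ : Metric.sphere (0 : V3) 1 → ℝ := fun ω => (Ψ ((ω : V3), v, w) - Ψ ((ω : V3), v', w')) * hardSphereKernel (w, v) ω
  set g₂ : Metric.sphere (0 : V3) 1 → ℝ := fun ω =>
    Ψ ((ω : V3), v', w') * (hardSphereKernel (w, v) ω - hardSphereKernel (w', v') ω)
  have hi₁ : Integrable f₁ sphereMeasure := integrable_sphereMeasure_of_continuous_V3 ((hf v w).mul (hk w v))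
  have hi₂ : Integrable f₂ sphereMeasure := integrable_sphereMeasure_of_continuous_V3 ((hf v' w').mul (hk w' v'))
  have hg₁ : Integrable g₁ sphereMeasure :=
    integrable_sphereMeasure_of_continuous_V3 (((hf v w).sub (hf v' w')).mul (hk w v))
  have hg₂ : Integrable g₂ sphereMeasure :=
    integrable_sphereMeasure_of_continuous_V3 ((hf v' w').mul ((hk w v).sub (hk w' v')))
  have hsplit : fluxAvg Ψ v w - fluxAvg Ψ v' w' = ∫ ω, g₁ ω ∂sphereMeasure + ∫ ω, g₂ ω ∂sphereMeasure := by
    unfold fluxAvg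
    rw [← integral_sub hi₁ hi₂, ← integral_add hg₁ hg₂]
    refine integral_congr_ae (ae_of_all _ fun ω => ?_)
    simp only [f₁, f₂, g₁, g₂]
    ring
  have h1 : |∫ ω, g₁ ω ∂sphereMeasure| ≤ m * (Real.pi * ‖w - v‖) := by
    have hb : ∀ ω, |g₁ ω| ≤ m * hardSphereKernel (w, v) ω := by
      intro ω
      have hk0 := (hardSphereKernel_nonneg_le v w ω).1
      simp only [g₁, abs_mul, abs_of_nonneg hk0]
      exact mul_le_mul_of_nonneg_right (hm ω) hk0
    calc |∫ ω, g₁ ω ∂sphereMeasure| ≤ ∫ ω, |g₁ ω| ∂sphereMeasure := abs_integral_le_integral_abs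
      _ ≤ ∫ ω, m * hardSphereKernel (w, v) ω ∂sphereMeasure :=
          integral_mono hg₁.abs ((integrable_sphereMeasure_of_continuous_V3 (hk w v)).const_mul m) hb
      _ = m * (Real.pi * ‖w - v‖) := by rw [integral_const_mul, integral_hardSphereKernel_eq_pi_mul_norm]
  have h2 : |∫ ω, g₂ ω ∂sphereMeasure| ≤ 4 * Real.pi * C * ‖(w - v) - (w' - v')‖ := by
    have hb : ∀ ω, |g₂ ω| ≤ C * ‖(w - v) - (w' - v')‖ := by
      intro ω
      simp only [g₂, abs_mul]
      exact mul_le_mul (hΨ _) (abs_hardSphereKernel_sub_le v w v' w' ω) (abs_nonneg _) hC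
    have h' := norm_integral_le_of_norm_le_const (μ := sphereMeasure) (f := g₂)
      (ae_of_all _ fun ω => by rw [Real.norm_eq_abs]; exact hb ω)
    rw [Real.norm_eq_abs, sphereMeasure_real_univ_V3] at h'
    calc |∫ ω, g₂ ω ∂sphereMeasure| ≤ C * ‖(w - v) - (w' - v')‖ * (4 * Real.pi) := h'
      _ = _ := by ring
  rw [hsplit]
  exact (abs_add_le _ _).trans (add_le_add h1 h2)

/-- **Ratio perturbation.** For `0 < F`, `0 ≤ F'`, `0 ≤ C` and `|a'| ≤ C F'` (so `a' = 0` when `F' = 0`, matching Lean's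
`a'/0 = 0`): `|a/F − a'/F'| ≤ |a − a'|/F + C |F − F'|/F`. [folklore] -/
theorem abs_div_sub_div_le_of_le_mul {a a' F F' C : ℝ} (hF : 0 < F) (hF' : 0 ≤ F') (hC : 0 ≤ C) (ha' : |a'| ≤ C * F') :
    |a / F - a' / F'| ≤ |a - a'| / F + C * |F - F'| / F := by
  rcases hF'.eq_or_lt with h0 | hpos
  · have ha0 : a' = 0 := by
      rw [← h0, mul_zero] at ha'
      exact abs_nonpos_iff.1 ha'
    rw [ha0, zero_div, sub_zero, sub_zero, abs_div, abs_of_pos hF]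
    have : 0 ≤ C * |F - F'| / F := by positivity
    linarith
  · have hkey : a / F - a' / F' = (a - a') / F + (a' / F') * ((F' - F) / F) := by
      field_simp
      ring
    have hq : |a' / F'| ≤ C := by
      rw [abs_div, abs_of_pos hpos, div_le_iff₀ hpos]
      exact ha'
    rw [hkey]
    calc |(a - a') / F + a' / F' * ((F' - F) / F)| ≤ |(a - a') / F| + |a' / F' * ((F' - F) / F)| := abs_add_le _ _
      _ = |a - a'| / F + |a' / F'| * (|F - F'| / F) := by
          rw [abs_mul, abs_div (a - a') F, abs_div (F' - F) F, abs_of_pos hF, abs_sub_comm F' F]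
      _ ≤ |a - a'| / F + C * (|F - F'| / F) := by gcongr
      _ = _ := by ring

/-- Markov under an energy cap: `#{i ∈ P : V < ‖u_i‖} ≤ E₀ #P / V²`. [folklore] -/
theorem card_fast_le {ι : Type*} (P : Finset ι) (u : ι → V3) {E₀ V : ℝ} (hV : 0 < V)
    (hE : ∑ i ∈ P, ‖u i‖ ^ 2 ≤ E₀ * P.card) :
    ((P.filter fun i => V < ‖u i‖).card : ℝ) ≤ E₀ * P.card / V ^ 2 := by
  rw [le_div_iff₀ (by positivity)]
  calc ((P.filter fun i => V < ‖u i‖).card : ℝ) * V ^ 2 = ∑ i ∈ P.filter (fun i => V < ‖u i‖), V ^ 2 := by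
        rw [Finset.sum_const, nsmul_eq_mul]
    _ ≤ ∑ i ∈ P.filter (fun i => V < ‖u i‖), ‖u i‖ ^ 2 := by
        refine Finset.sum_le_sum fun i hi => ?_
        have h := (Finset.mem_filter.1 hi).2
        exact pow_le_pow_left₀ hV.le h.le 2
    _ ≤ ∑ i ∈ P, ‖u i‖ ^ 2 := Finset.sum_le_sum_of_subset_of_nonneg (Finset.filter_subset _ _) fun i _ _ => by positivity
    _ ≤ E₀ * P.card := hE

/-- Under an energy cap the fast members carry little speed: `Σ_{i ∈ P, V < ‖u_i‖} ‖u_i‖ ≤ E₀ #P / V`. [folklore] -/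
theorem sum_fast_norm_le {ι : Type*} (P : Finset ι) (u : ι → V3) {E₀ V : ℝ} (hV : 0 < V)
    (hE : ∑ i ∈ P, ‖u i‖ ^ 2 ≤ E₀ * P.card) :
    ∑ i ∈ P.filter (fun i => V < ‖u i‖), ‖u i‖ ≤ E₀ * P.card / V := by
  rw [le_div_iff₀ hV]
  calc (∑ i ∈ P.filter (fun i => V < ‖u i‖), ‖u i‖) * V = ∑ i ∈ P.filter (fun i => V < ‖u i‖), ‖u i‖ * V := by
        rw [Finset.sum_mul]
    _ ≤ ∑ i ∈ P.filter (fun i => V < ‖u i‖), ‖u i‖ ^ 2 := by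
        refine Finset.sum_le_sum fun i hi => ?_
        have h := (Finset.mem_filter.1 hi).2
        rw [sq]
        exact mul_le_mul_of_nonneg_left h.le (norm_nonneg _)
    _ ≤ ∑ i ∈ P, ‖u i‖ ^ 2 := Finset.sum_le_sum_of_subset_of_nonneg (Finset.filter_subset _ _) fun i _ _ => by positivity
    _ ≤ E₀ * P.card := hE

/-- Cauchy–Schwarz under an energy cap: `Σ_P ‖u_i‖ ≤ #P √E₀`. [folklore] -/
theorem sum_norm_le_card_mul_sqrt {ι : Type*} (P : Finset ι) (u : ι → V3) {E₀ : ℝ} (hE0 : 0 ≤ E₀)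
    (hE : ∑ i ∈ P, ‖u i‖ ^ 2 ≤ E₀ * P.card) :
    ∑ i ∈ P, ‖u i‖ ≤ P.card * Real.sqrt E₀ := by
  have hcs := Finset.sum_mul_sq_le_sq_mul_sq P (fun i => ‖u i‖) (fun _ => (1 : ℝ))
  simp only [mul_one, one_pow, Finset.sum_const, nsmul_eq_mul, mul_one] at hcs
  have h2 : (∑ i ∈ P, ‖u i‖) ^ 2 ≤ (P.card * Real.sqrt E₀) ^ 2 := by
    calc (∑ i ∈ P, ‖u i‖) ^ 2 ≤ (∑ i ∈ P, ‖u i‖ ^ 2) * P.card := hcs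
      _ ≤ E₀ * P.card * P.card := mul_le_mul_of_nonneg_right hE (Nat.cast_nonneg _)
      _ = (P.card * Real.sqrt E₀) ^ 2 := by rw [mul_pow, Real.sq_sqrt hE0]; ring
  exact (pow_le_pow_iff_left₀ (Finset.sum_nonneg fun i _ => norm_nonneg _) (by positivity) two_ne_zero).1 h2

/-- **Fast pairs carry little flux under an energy cap**: over `P × Q`, the pairs with a member faster than `V` have
`Σ (‖v_i‖ + ‖v_j‖) ≤ 2 #P #Q (E₀/V + E₀ √E₀ / V²)`. [folklore] -/
theorem sum_fast_pairs_le {ι : Type*} (P Q : Finset ι) (u : ι → V3) {E₀ V : ℝ} (hE0 : 0 ≤ E₀) (hV : 0 < V)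
    (hP : ∑ i ∈ P, ‖u i‖ ^ 2 ≤ E₀ * P.card) (hQ : ∑ j ∈ Q, ‖u j‖ ^ 2 ≤ E₀ * Q.card) :
    ∑ p ∈ (P ×ˢ Q).filter (fun p => V < ‖u p.1‖ ∨ V < ‖u p.2‖), (‖u p.1‖ + ‖u p.2‖) ≤
      2 * (P.card * Q.card) * (E₀ / V + E₀ * Real.sqrt E₀ / V ^ 2) := by
  -- split the `∨`
  have hsplit : ∑ p ∈ (P ×ˢ Q).filter (fun p => V < ‖u p.1‖ ∨ V < ‖u p.2‖), (‖u p.1‖ + ‖u p.2‖) ≤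
      ∑ p ∈ (P ×ˢ Q).filter (fun p => V < ‖u p.1‖), (‖u p.1‖ + ‖u p.2‖) +
        ∑ p ∈ (P ×ˢ Q).filter (fun p => V < ‖u p.2‖), (‖u p.1‖ + ‖u p.2‖) := by
    rw [← Finset.sum_union_inter]
    have h0 : 0 ≤ ∑ p ∈ (P ×ˢ Q).filter (fun p => V < ‖u p.1‖) ∩ (P ×ˢ Q).filter (fun p => V < ‖u p.2‖),
        (‖u p.1‖ + ‖u p.2‖) := Finset.sum_nonneg fun p _ => by positivity
    have h1 : ∑ p ∈ (P ×ˢ Q).filter (fun p => V < ‖u p.1‖ ∨ V < ‖u p.2‖), (‖u p.1‖ + ‖u p.2‖) =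
        ∑ p ∈ (P ×ˢ Q).filter (fun p => V < ‖u p.1‖) ∪ (P ×ˢ Q).filter (fun p => V < ‖u p.2‖),
          (‖u p.1‖ + ‖u p.2‖) := by rw [← Finset.filter_or]
    linarith
  have h3P := sum_norm_le_card_mul_sqrt P u hE0 hP
  have h3Q := sum_norm_le_card_mul_sqrt Q u hE0 hQ
  -- the `i fast` half
  have hfst : ∑ p ∈ (P ×ˢ Q).filter (fun p => V < ‖u p.1‖), (‖u p.1‖ + ‖u p.2‖) ≤
      (P.card * Q.card) * (E₀ / V + E₀ * Real.sqrt E₀ / V ^ 2) := by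
    rw [Finset.filter_product_left fun i => V < ‖u i‖, Finset.sum_product]
    have h1 := sum_fast_norm_le P u hV hP
    have h2 := card_fast_le P u hV hP
    have hinner : ∀ i, ∑ j ∈ Q, (‖u i‖ + ‖u j‖) = Q.card * ‖u i‖ + ∑ j ∈ Q, ‖u j‖ := by
      intro i
      rw [Finset.sum_add_distrib, Finset.sum_const, nsmul_eq_mul]
    simp_rw [hinner]
    rw [Finset.sum_add_distrib, Finset.sum_const, nsmul_eq_mul, ← Finset.mul_sum]
    have hQ0 : (0 : ℝ) ≤ ∑ j ∈ Q, ‖u j‖ := Finset.sum_nonneg fun j _ => norm_nonneg _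
    calc (Q.card : ℝ) * ∑ i ∈ P.filter (fun i => V < ‖u i‖), ‖u i‖ +
          ((P.filter (fun i => V < ‖u i‖)).card : ℝ) * ∑ j ∈ Q, ‖u j‖
        ≤ (Q.card : ℝ) * (E₀ * P.card / V) + (E₀ * P.card / V ^ 2) * (Q.card * Real.sqrt E₀) := by
          gcongr
      _ = (P.card * Q.card) * (E₀ / V + E₀ * Real.sqrt E₀ / V ^ 2) := by
          field_simp
  -- the `j fast` half
  have hsnd : ∑ p ∈ (P ×ˢ Q).filter (fun p => V < ‖u p.2‖), (‖u p.1‖ + ‖u p.2‖) ≤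
      (P.card * Q.card) * (E₀ / V + E₀ * Real.sqrt E₀ / V ^ 2) := by
    rw [Finset.filter_product_right (q := fun j => V < ‖u j‖), Finset.sum_product]
    have h1 := sum_fast_norm_le Q u hV hQ
    have h2 := card_fast_le Q u hV hQ
    have hinner : ∀ i, ∑ j ∈ Q.filter (fun j => V < ‖u j‖), (‖u i‖ + ‖u j‖) =
        (Q.filter (fun j => V < ‖u j‖)).card * ‖u i‖ + ∑ j ∈ Q.filter (fun j => V < ‖u j‖), ‖u j‖ := by
      intro i
      rw [Finset.sum_add_distrib, Finset.sum_const, nsmul_eq_mul]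
    simp_rw [hinner]
    rw [Finset.sum_add_distrib, Finset.sum_const, nsmul_eq_mul, ← Finset.mul_sum]
    have hP0 : (0 : ℝ) ≤ ∑ i ∈ P, ‖u i‖ := Finset.sum_nonneg fun i _ => norm_nonneg _
    calc ((Q.filter (fun j => V < ‖u j‖)).card : ℝ) * ∑ i ∈ P, ‖u i‖ +
          (P.card : ℝ) * ∑ j ∈ Q.filter (fun j => V < ‖u j‖), ‖u j‖
        ≤ (E₀ * Q.card / V ^ 2) * (P.card * Real.sqrt E₀) + (P.card : ℝ) * (E₀ * Q.card / V) := by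
          gcongr
      _ = (P.card * Q.card) * (E₀ / V + E₀ * Real.sqrt E₀ / V ^ 2) := by
          field_simp
          ring
  linarith


/-- **Stability of a flux-weighted pair average under a bin-scale perturbation of the velocities (tame pairs).** For finite
families `u, u'` with `‖u'_i − u_i‖ ≤ β`, a set `S ⊆ P × Q` of ordered pairs carrying total relative speed at least `s₀ #P #Q`
(not cold), energy caps `Σ_P ‖u‖² ≤ E₀ #P`, `Σ_Q ‖u‖² ≤ E₀ #Q` (not hot), a continuous mark test `Ψ` bounded by `C` with
`|Ψ(ω,a,b) − Ψ(ω,a',b')| ≤ m` whenever `‖a‖, ‖b‖ ≤ V` and `‖a'−a‖, ‖b'−b‖ ≤ β`: the flux-weighted averages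
`Σ_S fluxAvg Ψ / Σ_S fluxAvg 1` at `u` and at `u'` differ by at most `m + 4C(E₀/V + E₀√E₀/V²)/s₀ + 10 C β/s₀`. [folklore] -/
theorem abs_fluxRatio_sub_le {ι : Type*} (P Q : Finset ι) (S : Finset (ι × ι)) (hS : S ⊆ P ×ˢ Q)
    (u u' : ι → V3) {β : ℝ} (hβ : 0 ≤ β) (hu : ∀ i, ‖u' i - u i‖ ≤ β)
    {s₀ E₀ : ℝ} (hs₀ : 0 < s₀) (hE0 : 0 ≤ E₀)
    (hcold : s₀ * (P.card * Q.card) ≤ ∑ p ∈ S, ‖u p.1 - u p.2‖)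
    (hP : ∑ i ∈ P, ‖u i‖ ^ 2 ≤ E₀ * P.card) (hQ : ∑ j ∈ Q, ‖u j‖ ^ 2 ≤ E₀ * Q.card)
    {Ψ : V3 × V3 × V3 → ℝ} (hΨc : Continuous Ψ) {C : ℝ} (hΨ : ∀ p, |Ψ p| ≤ C)
    {V m : ℝ} (hV : 0 < V) (hm : 0 ≤ m)
    (hmod : ∀ (ω : Metric.sphere (0 : V3) 1) (a b a' b' : V3), ‖a‖ ≤ V → ‖b‖ ≤ V → ‖a' - a‖ ≤ β →
      ‖b' - b‖ ≤ β → |Ψ ((ω : V3), a, b) - Ψ ((ω : V3), a', b')| ≤ m) :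
    |(∑ p ∈ S, fluxAvg Ψ (u p.1) (u p.2)) / (∑ p ∈ S, fluxAvg (fun _ => 1) (u p.1) (u p.2)) -
        (∑ p ∈ S, fluxAvg Ψ (u' p.1) (u' p.2)) / (∑ p ∈ S, fluxAvg (fun _ => 1) (u' p.1) (u' p.2))| ≤
      m + 4 * C * (E₀ / V + E₀ * Real.sqrt E₀ / V ^ 2) / s₀ + 10 * C * β / s₀ := by
  have hC : 0 ≤ C := (abs_nonneg _).trans (hΨ 0)
  set X := E₀ / V + E₀ * Real.sqrt E₀ / V ^ 2 with hX
  have hX0 : 0 ≤ X := by positivity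
  -- notation
  set a : ι × ι → ℝ := fun p => fluxAvg Ψ (u p.1) (u p.2) with ha
  set a' : ι × ι → ℝ := fun p => fluxAvg Ψ (u' p.1) (u' p.2) with ha'
  set f : ι × ι → ℝ := fun p => fluxAvg (fun _ => 1) (u p.1) (u p.2) with hf
  set f' : ι × ι → ℝ := fun p => fluxAvg (fun _ => 1) (u' p.1) (u' p.2) with hf'
  set d : ι × ι → ℝ := fun p => ‖u p.1 - u p.2‖ with hd
  have hfd : ∀ p, f p = Real.pi * d p := fun p => by simp only [hf, hd, fluxAvg_one_eq, norm_sub_rev]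
  have hf'd : ∀ p, f' p = Real.pi * ‖u' p.1 - u' p.2‖ := fun p => by simp only [hf', fluxAvg_one_eq, norm_sub_rev]
  have hF : ∑ p ∈ S, f p = Real.pi * ∑ p ∈ S, d p := by rw [Finset.mul_sum]; exact Finset.sum_congr rfl fun p _ => hfd p
  have hcardS : (S.card : ℝ) ≤ P.card * Q.card := by
    have := Finset.card_le_card hS
    rw [Finset.card_product] at this
    exact_mod_cast this
  -- the degenerate case `#P #Q = 0`: no pairs at all
  rcases (show (0 : ℝ) ≤ P.card * Q.card by positivity).eq_or_lt with h0 | hPQ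
  · have hS0 : S = ∅ := by
      have : S.card = 0 := by
        have h := hcardS
        rw [← h0] at h
        exact_mod_cast le_antisymm h (Nat.cast_nonneg _)
      exact Finset.card_eq_zero.1 this
    simp only [hS0, Finset.sum_empty, div_zero, sub_zero, abs_zero]
    positivity
  -- the flux is bounded below
  have hFpos : Real.pi * (s₀ * (P.card * Q.card)) ≤ ∑ p ∈ S, f p := by
    rw [hF]; exact mul_le_mul_of_nonneg_left hcold Real.pi_pos.le
  have hF0 : 0 < ∑ p ∈ S, f p := lt_of_lt_of_le (by positivity) hFpos
  have hF'0 : 0 ≤ ∑ p ∈ S, f' p := Finset.sum_nonneg fun p _ => fluxAvg_one_nonneg _ _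
  -- `|A'| ≤ C F'`
  have hA' : |∑ p ∈ S, a' p| ≤ C * ∑ p ∈ S, f' p := by
    rw [Finset.mul_sum]
    exact (Finset.abs_sum_le_sum_abs _ _).trans (Finset.sum_le_sum fun p _ => abs_fluxAvg_le hΨc hΨ _ _)
  -- termwise perturbation of `a`
  set g : ι × ι → ℝ := fun p => if V < ‖u p.1‖ ∨ V < ‖u p.2‖ then Real.pi * d p else 0 with hg
  have hterm : ∀ p ∈ S, |a p - a' p| ≤ m * f p + 2 * C * g p + 8 * Real.pi * C * β := by
    intro p _
    have hδ : ‖(u p.2 - u p.1) - (u' p.2 - u' p.1)‖ ≤ 2 * β := by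
      calc ‖(u p.2 - u p.1) - (u' p.2 - u' p.1)‖ = ‖(u' p.1 - u p.1) - (u' p.2 - u p.2)‖ := by
            congr 1; abel
        _ ≤ ‖u' p.1 - u p.1‖ + ‖u' p.2 - u p.2‖ := norm_sub_le _ _
        _ ≤ β + β := add_le_add (hu _) (hu _)
        _ = 2 * β := by ring
    have h4 : 4 * Real.pi * C * ‖(u p.2 - u p.1) - (u' p.2 - u' p.1)‖ ≤ 4 * Real.pi * C * (2 * β) :=
      mul_le_mul_of_nonneg_left hδ (by positivity)
    have hfp : f p = Real.pi * ‖u p.2 - u p.1‖ := by rw [hfd]; simp only [hd, norm_sub_rev]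
    have hdp0 : 0 ≤ Real.pi * ‖u p.2 - u p.1‖ := by positivity
    by_cases hfast : V < ‖u p.1‖ ∨ V < ‖u p.2‖
    · -- a fast pair: only `|Ψ| ≤ C` is used
      have h2C : ∀ ω : Metric.sphere (0 : V3) 1, |Ψ ((ω : V3), u p.1, u p.2) - Ψ ((ω : V3), u' p.1, u' p.2)| ≤ 2 * C :=
        fun ω => (abs_sub _ _).trans (by linarith [hΨ ((ω : V3), u p.1, u p.2), hΨ ((ω : V3), u' p.1, u' p.2)])
      have h := abs_fluxAvg_sub_fluxAvg_le hΨc hΨ (u p.1) (u p.2) (u' p.1) (u' p.2) h2C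
      have hgp : g p = Real.pi * ‖u p.2 - u p.1‖ := by simp only [hg, if_pos hfast, hd, norm_sub_rev]
      have hm0 : 0 ≤ m * (Real.pi * ‖u p.2 - u p.1‖) := by positivity
      simp only [ha, ha']
      rw [hgp, hfp]
      linarith
    · -- a slow pair: the modulus applies
      have hslow : ‖u p.1‖ ≤ V ∧ ‖u p.2‖ ≤ V := by
        rcases not_or.1 hfast with ⟨h1, h2⟩
        exact ⟨not_lt.1 h1, not_lt.1 h2⟩
      have hmm : ∀ ω : Metric.sphere (0 : V3) 1, |Ψ ((ω : V3), u p.1, u p.2) - Ψ ((ω : V3), u' p.1, u' p.2)| ≤ m :=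
        fun ω => hmod ω _ _ _ _ hslow.1 hslow.2 (hu _) (hu _)
      have h := abs_fluxAvg_sub_fluxAvg_le hΨc hΨ (u p.1) (u p.2) (u' p.1) (u' p.2) hmm
      have hgp : g p = 0 := by simp only [hg, if_neg hfast]
      simp only [ha, ha']
      rw [hgp, hfp]
      linarith
  -- summing the termwise bound
  have hgsum : ∑ p ∈ S, g p ≤ Real.pi * (2 * (P.card * Q.card) * X) := by
    rw [hg, ← Finset.sum_filter, ← Finset.mul_sum]
    refine mul_le_mul_of_nonneg_left ?_ Real.pi_pos.le
    calc ∑ p ∈ S.filter (fun p => V < ‖u p.1‖ ∨ V < ‖u p.2‖), d p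
        ≤ ∑ p ∈ S.filter (fun p => V < ‖u p.1‖ ∨ V < ‖u p.2‖), (‖u p.1‖ + ‖u p.2‖) :=
          Finset.sum_le_sum fun p _ => norm_sub_le _ _
      _ ≤ ∑ p ∈ (P ×ˢ Q).filter (fun p => V < ‖u p.1‖ ∨ V < ‖u p.2‖), (‖u p.1‖ + ‖u p.2‖) :=
          Finset.sum_le_sum_of_subset_of_nonneg (Finset.filter_subset_filter _ hS) fun p _ _ => by positivity
      _ ≤ 2 * (P.card * Q.card) * X := sum_fast_pairs_le P Q u hE0 hV hP hQ
  have hsumA : ∑ p ∈ S, |a p - a' p| ≤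
      m * ∑ p ∈ S, f p + 4 * Real.pi * C * (P.card * Q.card) * X + 8 * Real.pi * C * β * S.card := by
    calc ∑ p ∈ S, |a p - a' p| ≤ ∑ p ∈ S, (m * f p + 2 * C * g p + 8 * Real.pi * C * β) := Finset.sum_le_sum hterm
      _ = m * ∑ p ∈ S, f p + 2 * C * ∑ p ∈ S, g p + ∑ p ∈ S, 8 * Real.pi * C * β := by
          rw [Finset.sum_add_distrib, Finset.sum_add_distrib, Finset.mul_sum, Finset.mul_sum]
      _ = m * ∑ p ∈ S, f p + 2 * C * ∑ p ∈ S, g p + 8 * Real.pi * C * β * S.card := by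
          rw [Finset.sum_const, nsmul_eq_mul]; ring
      _ ≤ _ := by
          have := mul_le_mul_of_nonneg_left hgsum (by positivity : 0 ≤ 2 * C)
          nlinarith [this]
  -- perturbation of the flux
  have hsumF : |∑ p ∈ S, f p - ∑ p ∈ S, f' p| ≤ 2 * Real.pi * β * S.card := by
    rw [← Finset.sum_sub_distrib]
    refine (Finset.abs_sum_le_sum_abs _ _).trans ?_
    calc ∑ p ∈ S, |f p - f' p| ≤ ∑ p ∈ S, 2 * Real.pi * β := by
          refine Finset.sum_le_sum fun p _ => ?_
          rw [hfd, hf'd]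
          simp only [hd]
          rw [← mul_sub, abs_mul, abs_of_pos Real.pi_pos]
          have h := abs_norm_sub_norm_le (u p.1 - u p.2) (u' p.1 - u' p.2)
          have h' : ‖(u p.1 - u p.2) - (u' p.1 - u' p.2)‖ ≤ 2 * β := by
            calc ‖(u p.1 - u p.2) - (u' p.1 - u' p.2)‖ = ‖(u' p.2 - u p.2) - (u' p.1 - u p.1)‖ := by congr 1; abel
              _ ≤ ‖u' p.2 - u p.2‖ + ‖u' p.1 - u p.1‖ := norm_sub_le _ _
              _ ≤ β + β := add_le_add (hu _) (hu _)
              _ = 2 * β := by ring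
          have : Real.pi * |‖u p.1 - u p.2‖ - ‖u' p.1 - u' p.2‖| ≤ Real.pi * (2 * β) :=
            mul_le_mul_of_nonneg_left (h.trans h') Real.pi_pos.le
          linarith
      _ = 2 * Real.pi * β * S.card := by rw [Finset.sum_const, nsmul_eq_mul]; ring
  -- the ratio lemma and the arithmetic
  set F := ∑ p ∈ S, f p with hFdef
  set N₀ : ℝ := P.card * Q.card with hN₀
  have hratio := abs_div_sub_div_le_of_le_mul (a := ∑ p ∈ S, a p) hF0 hF'0 hC hA'
  have hAA : |∑ p ∈ S, a p - ∑ p ∈ S, a' p| ≤ ∑ p ∈ S, |a p - a' p| := by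
    rw [← Finset.sum_sub_distrib]; exact Finset.abs_sum_le_sum_abs _ _
  have h8 : 8 * Real.pi * C * β * S.card ≤ 8 * Real.pi * C * β * N₀ := mul_le_mul_of_nonneg_left hcardS (by positivity)
  have h2 : C * |F - ∑ p ∈ S, f' p| ≤ 2 * Real.pi * C * β * N₀ := by
    calc C * |F - ∑ p ∈ S, f' p| ≤ C * (2 * Real.pi * β * S.card) := mul_le_mul_of_nonneg_left hsumF hC
      _ ≤ C * (2 * Real.pi * β * N₀) := by gcongr
      _ = _ := by ring
  have hnum : ∑ p ∈ S, |a p - a' p| + C * |F - ∑ p ∈ S, f' p| ≤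
      m * F + (4 * Real.pi * C * X + 10 * Real.pi * C * β) * N₀ := by
    nlinarith [hsumA, h8, h2]
  have hK0 : 0 ≤ (4 * Real.pi * C * X + 10 * Real.pi * C * β) * N₀ := by positivity
  calc |(∑ p ∈ S, a p) / F - (∑ p ∈ S, a' p) / ∑ p ∈ S, f' p|
      ≤ |∑ p ∈ S, a p - ∑ p ∈ S, a' p| / F + C * |F - ∑ p ∈ S, f' p| / F := hratio
    _ ≤ (∑ p ∈ S, |a p - a' p|) / F + C * |F - ∑ p ∈ S, f' p| / F := by gcongr
    _ = (∑ p ∈ S, |a p - a' p| + C * |F - ∑ p ∈ S, f' p|) / F := by rw [add_div]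
    _ ≤ (m * F + (4 * Real.pi * C * X + 10 * Real.pi * C * β) * N₀) / F := div_le_div_of_nonneg_right hnum hF0.le
    _ = m + (4 * Real.pi * C * X + 10 * Real.pi * C * β) * N₀ / F := by
        rw [add_div, mul_div_assoc, div_self hF0.ne', mul_one]
    _ ≤ m + (4 * Real.pi * C * X + 10 * Real.pi * C * β) * N₀ / (Real.pi * (s₀ * N₀)) := by
        gcongr
    _ = m + 4 * C * X / s₀ + 10 * C * β / s₀ := by
        have hN : N₀ ≠ 0 := hPQ.ne'
        field_simp
        ring

end Summit.AtomisticToContinuum.HydrodynamicLimit.Theorems.EquilibriumForecastLine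

end
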